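import Literature.NumberTheory.Automorphic.ShimuraCurveRibetTakahashiPairwiseEisensteinProofs
import Literature.NumberTheory.EllipticCurves.TakahashiRankOneOfTraceFormula
import Literature.NumberTheory.EllipticCurves.TakahashiDegreeFormulaCoprimeProofs
import Literature.NumberTheory.Automorphic.BrandtEigenLine
import Literature.NumberTheory.EllipticCurves.TakahashiDegreeFormulaFromDictionaryHolds
import HarnessLib

/-!
# Stub ideation k1, GEN 12 (FAMILY 1 — recognise & import) for `stub_takahashi`
# (crux `DefiniteXi.DefiniteRTControlPrime`, stmt-ABC-11338)

Companion of `STUB-IDEAS-stub_takahashi-1.md` (gen 12).  Self-contained (Cruxes modules are not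
built on the farm, so the gen-6 leaves `H2flat`, `H1` are inlined VERBATIM).  New in gen 12:

* `HB`  = the hypothesis `hB` of the TREE theorem
  `Literature.NumberTheory.EllipticCurves.takahashi2001_brandtEigenLattice_rank_one_of_traceFormulas`
  (`EichlerBasisTheoremOfTraceFormulas.lean`, 2026-08-17), verbatim: Eichler's trace formula for the
  Brandt matrices `B(n; p, M)` in Cohen–Oesterlé organisation, `M` ARBITRARY with `p ∤ M` — the one
  Brandt-side input; its square-free-`M` case is the tree theorem
  `Brandt.XiSetup.trace_matrix_eq_eichlerSelberg` (granting `brandtModule_massFormula`), `HB_of_squarefree`.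
* `HTF` = the EXISTING named fact `HeckeTraceFormulaGL2Level N 1 2` at all levels (by name).
* `H1C` = multiplicity one over `ℂ` (the printed form: Pizer 1980 Thm. 2.28 with `r = 0`;
  Helm 2007 L. 4.13 / Rem. 4.1; Conrad–Stein 2001 §7.4), bridged to `H1` by the tree lemma
  `BrandtJL.finrank_eigenLattice_eq_one_of_finrank_eigenSpace_eq_one`.
* assemblies (all PROVED): `H1_of_traceFormulas : HTF → HB → H1` (tree `traceIdentity_of_traceFormulas`,
  general `M`, + `BrandtJL.finrank_eigenLattice_eq_one_of_traceIdentity`), `H1_of_complex`,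
  `stub_of_rankOne_of_flat`, `stub_of_flat_of_traceFormulas : H2flat → HTF → HB → stub`,
  `stub_of_flat_of_complex : H2flat → H1C → stub`.
-/

noncomputable section

open scoped BigOperators ArithmeticFunction.sigma
open ArithmeticFunction

namespace Summit.ABC.ABC.Cruxes.DefiniteRTControlPrime.StubIdeas1G12

open Literature.NumberTheory.EllipticCurves Literature.NumberTheory.EllipticCurves.ModularForms
open Literature.NumberTheory.Automorphic Literature.NumberTheory.Automorphic.Brandt
open Literature.NumberTheory.Automorphic.HeckeTraceFormulaGL2Level

/-! ### Leaves (gen-6 texts verbatim) -/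

/-- **H2♭** (FACT-GRADE leaf; proposed name `takahashi2001_characterGroupDictionary_of_coprime`):
`hDict` of `…PairwiseEisensteinProofs` minus its `finrank … = 1` conjunct (gen-6 text verbatim). -/
def H2flat : Prop :=
  ∀ (W : WeierstrassCurve ℚ) [W.IsElliptic] (M r : ℕ) [NeZero (M * r)],
    r.Prime → M.Coprime r → W.conductorNorm ℤ = M * r →
    ∀ P : ModularParametrizationData W (M * r),
      (∀ (W' : WeierstrassCurve ℚ) [W'.IsElliptic], W'.conductorNorm ℤ = M * r →
          ∀ P' : ModularParametrizationData W' (M * r),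
          P'.f = P.f → P.modularDegree ≤ P'.modularDegree) →
      ∀ (S : Brandt.XiSetup M r) [Fintype (Brandt.ClassSet S.O)],
        ∃ (X : Submodule ℤ (Brandt.ClassSet S.O → ℤ)) (pb : ℤ →ₗ[ℤ] X) (pf : X →ₗ[ℤ] ℤ),
          (∀ (a : ℤ) (y : X),
              ∑ i, (Brandt.weight S.O i : ℤ) * (pb a : Brandt.ClassSet S.O → ℤ) i *
                  (y : Brandt.ClassSet S.O → ℤ) i =
                ((W.minimalDiscriminantNorm ℤ).factorization r : ℤ) * a * pf y) ∧
          (∀ a : ℤ, pf (pb a) = (P.modularDegree : ℤ) * a) ∧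
          Function.Surjective pf ∧
          (∀ (m : ℤ) (v : Brandt.ClassSet S.O → ℤ), m ≠ 0 → m • v ∈ X → v ∈ X) ∧
          (∀ v : Brandt.ClassSet S.O → ℤ, ∑ i, v i = 0 → v ∈ X) ∧
          (pb 1 : Brandt.ClassSet S.O → ℤ) ∈
            Brandt.eigenLattice (M * r) (Brandt.matrix S.O) (fun n => W.LFunction n)

/-- **H1** (rank one of the `a(W)`-eigen-lattice at coprime level; gen-6 text verbatim). -/
def H1 : Prop :=
  ∀ (W : WeierstrassCurve ℚ) [W.IsElliptic] (M r : ℕ) [NeZero (M * r)],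
    r.Prime → M.Coprime r → W.conductorNorm ℤ = M * r →
    ∀ (_P : ModularParametrizationData W (M * r)) (S : Brandt.XiSetup M r)
      [Fintype (Brandt.ClassSet S.O)],
      Module.finrank ℤ
        (Brandt.eigenLattice (M * r) (Brandt.matrix S.O) (fun n => W.LFunction n)) = 1

/-! ### Gen-12 leaves: existing tree currency, cited by name -/

/-- **HTF**: the EXISTING named fact, Eichler–Selberg on `S₂(Γ₀(N))` for every `N`
(`Literature.NumberTheory.Automorphic.HeckeTraceFormulaGL2Level N 1 2`, Schoof–van der Vlugt Thm. 2.2). -/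
def HTF : Prop := ∀ (N : ℕ) [NeZero N], HeckeTraceFormulaGL2Level N 1 2

/-- **HB**: Eichler's trace formula for `tr B(n; p, M)`, `(n, Mp) = 1`, Cohen–Oesterlé organisation,
`M` ARBITRARY prime to `p` — verbatim the binder `hB` of the tree theorem
`takahashi2001_brandtEigenLattice_rank_one_of_traceFormulas`.  Square-free `M`: tree theorem
(`HB_of_squarefree`); general `M`: k3's local Hijikata layer (H6) or a named fact
(Eichler 1955 (5); Pizer 1980 Thm. 2.25/Rem. 2.26 cite Hijikata–Saito Lemma 1, Pizer 1976 Thm. 4). -/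
def HB : Prop :=
  ∀ (M p : ℕ) [NeZero M] [NeZero (M * p)], p.Prime → ¬ p ∣ M →
    ∀ (S : XiSetup M p) [Fintype (ClassSet S.O)] (n : ℕ), 0 < n → n.Coprime (M * p) →
      (((Brandt.matrix S.O n).trace : ℤ) : ℂ) =
        (if IsSquare n then ((p : ℂ) - 1) * (dedekindPsi M : ℂ) / 12 else 0) +
          (1 / 2 : ℂ) *
            ∑ t ∈ (Finset.Icc (-(2 * n : ℤ)) (2 * n)).filter (fun t : ℤ => t ^ 2 < 4 * (n : ℤ)),
              ∑ f ∈ ellipticConductors t n,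
                (weightedClassNumber ((t ^ 2 - 4 * n) / (f : ℤ) ^ 2) : ℂ) *
                  (localDensity M 1 t f n * (2 - localDensity p 1 t f n))

/-- **H1ℂ**: multiplicity one over `ℂ` for the `a(W)`-eigen-system in `ℂ^{Cls O}` at coprime
level (the PRINTED form of rank one: Pizer 1980 Thm. 2.28 (`r = 0`) + newform multiplicity one;
Helm 2007 Lemma 4.13 / Remark 4.1; Conrad–Stein 2001 §7.4 (2)). -/
def H1C : Prop :=
  ∀ (W : WeierstrassCurve ℚ) [W.IsElliptic] (M r : ℕ) [NeZero (M * r)],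
    r.Prime → M.Coprime r → W.conductorNorm ℤ = M * r →
    ∀ (_P : ModularParametrizationData W (M * r)) (S : Brandt.XiSetup M r)
      [Fintype (Brandt.ClassSet S.O)],
      Module.finrank ℂ
        (Brandt.eigenSpace ℂ (M * r) (Brandt.matrix S.O) (fun n => W.LFunction n)) = 1

/-! ### Assemblies (all proved) -/

/-- `r ∤ M` from `gcd(M, r) = 1`, `r` prime. [folklore] -/
theorem not_dvd_of_coprime {M r : ℕ} (hr : r.Prime) (hcop : M.Coprime r) : ¬ r ∣ M :=
  fun h => hr.ne_one ((Nat.coprime_comm.mp hcop).eq_one_of_dvd h)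

/-- **HTF ∧ HB ⇒ H1** — by the tree theorems `traceIdentity_of_traceFormulas` (general `M`,
only `p ∤ M`) and `BrandtJL.finrank_eigenLattice_eq_one_of_traceIdentity`. -/
theorem H1_of_traceFormulas (hTF : HTF) (hB : HB) : H1 := by
  intro W _ M r _ hr hcop _hN P S _
  haveI : NeZero M := ⟨fun hM => NeZero.ne (M * r) (by rw [hM, zero_mul])⟩
  exact BrandtJL.finrank_eigenLattice_eq_one_of_traceIdentity S
    (traceIdentity_of_traceFormulas hr (not_dvd_of_coprime hr hcop) S (hTF _) (hTF _)
      (hB M r hr (not_dvd_of_coprime hr hcop) S)) W hr.one_lt P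

/-- **H1ℂ ⇒ H1** — descent `ℂ → ℤ` by the tree lemma
`BrandtJL.finrank_eigenLattice_eq_one_of_finrank_eigenSpace_eq_one`. -/
theorem H1_of_complex (h : H1C) : H1 := by
  intro W _ M r _ hr hcop hN P S _
  exact BrandtJL.finrank_eigenLattice_eq_one_of_finrank_eigenSpace_eq_one (h W M r hr hcop hN P S)

/-- **H1 ∧ H2♭ ⇒ the stub** (gen-6 A2+A3: re-insert the rank conjunct, feed the tree consumer
`takahashi2001_thm_2_3_of_coprime_of_brandtDictionary`). -/
theorem stub_of_rankOne_of_flat (h1 : H1) (h2 : H2flat) : takahashi2001_thm_2_3_of_coprime :=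
  takahashi2001_thm_2_3_of_coprime_of_brandtDictionary fun W _ M r _ hr hcop hN P hmin S _ => by
    obtain ⟨X, pb, pf, hadj, hδ, hsurj, hsat, hdeg, hmem⟩ := h2 W M r hr hcop hN P hmin S
    exact ⟨X, pb, pf, hadj, hδ, hsurj, hsat, hdeg, h1 W M r hr hcop hN P S, hmem⟩

/-- **The stub from H2♭ + the existing named fact `HeckeTraceFormulaGL2Level` + HB.** -/
theorem stub_of_flat_of_traceFormulas (h2 : H2flat) (hTF : HTF) (hB : HB) :
    takahashi2001_thm_2_3_of_coprime :=
  stub_of_rankOne_of_flat (H1_of_traceFormulas hTF hB) h2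

/-- **The stub from H2♭ + multiplicity one over `ℂ`.** -/
theorem stub_of_flat_of_complex (h2 : H2flat) (h : H1C) : takahashi2001_thm_2_3_of_coprime :=
  stub_of_rankOne_of_flat (H1_of_complex h) h2

/-- **Sanity: HB at square-free `M` is a tree theorem** granting Eichler's mass formula
(`Brandt.XiSetup.trace_matrix_eq_eichlerSelberg`); only the `q² ∣ M` places are open (k3 H6). -/
theorem HB_of_squarefree (hmass : brandtModule_massFormula) :
    ∀ (M p : ℕ) [NeZero M] [NeZero (M * p)], Squarefree M → p.Prime → ¬ p ∣ M →
      ∀ (S : XiSetup M p) [Fintype (ClassSet S.O)] (n : ℕ), 0 < n → n.Coprime (M * p) →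
        (((Brandt.matrix S.O n).trace : ℤ) : ℂ) =
          (if IsSquare n then ((p : ℂ) - 1) * (dedekindPsi M : ℂ) / 12 else 0) +
            (1 / 2 : ℂ) *
              ∑ t ∈ (Finset.Icc (-(2 * n : ℤ)) (2 * n)).filter (fun t : ℤ => t ^ 2 < 4 * (n : ℤ)),
                ∑ f ∈ ellipticConductors t n,
                  (weightedClassNumber ((t ^ 2 - 4 * n) / (f : ℤ) ^ 2) : ℂ) *
                    (localDensity M 1 t f n * (2 - localDensity p 1 t f n)) :=
  fun _M _p _ _ hsq hp hpM S _ n hn0 hn => S.trace_matrix_eq_eichlerSelberg hsq hp hpM hmass n hn0 hn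

/-- **Sanity: H1 at square-free level is the tree's PROVED named fact** (`…_rank_one_holds`, via the
in-tree Eichler–Selberg theorem `ModularForms.cuspidalHeckeTrace_eq_geometricSide`, square-free `N`). -/
theorem H1_of_squarefree :
    ∀ (W : WeierstrassCurve ℚ) [W.IsElliptic] (M r : ℕ) [NeZero (M * r)],
      r.Prime → Squarefree (M * r) → W.conductorNorm ℤ = M * r →
      ∀ (_P : ModularParametrizationData W (M * r)) (S : Brandt.XiSetup M r)
        [Fintype (Brandt.ClassSet S.O)],
        Module.finrank ℤ
          (Brandt.eigenLattice (M * r) (Brandt.matrix S.O) (fun n => W.LFunction n)) = 1 :=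
  fun W _ M r _ hr hsq hN P S _ => takahashi2001_brandtEigenLattice_rank_one_holds W M r hr hsq hN P S

end Summit.ABC.ABC.Cruxes.DefiniteRTControlPrime.StubIdeas1G12

end
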